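import Summits.CriticalPhenomena.PercolationContinuityZ3.Theorems.Transplant.SkelFrmBChoiceDefs3
import Summits.CriticalPhenomena.PercolationContinuityZ3.Theorems.Transplant.SkelPhiCellsFineGeomS
import Summits.CriticalPhenomena.PercolationContinuityZ3.Theorems.Transplant.SkelNeg1ChoiceAll
import HarnessLib

/-!
# N2 (frames-only node `SamePDropOfSkeletonFrm₁`, OPEN), WAVE 1: THE GEOMETRIC OBLIGATION OF THE CHOICE FUNCTION OF RECORD —
# `PlanarSkeletonFrm.geomHoldsNQFn_frmChoiceAllQ3 : ∀ gv fv Pv Sv cv bv, GeomHoldsNQFn (frmChoiceAllQ3 gv fv Pv Sv cv bv)` (ruling (R-31))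

The N2 twin of N1's `geom_fineA_at_b` / `geomHoldsNOFn_negChoiceAllOTA` (SkelNegBChoiceAllTA §3) over the STAGGERED cells `fcellsS` and hp-8 g40's scheme geometry
`cellGeomSG₂bS / faceDataSGS / levelDataSS` (SkelPhiCellsSmallMS, SkelPhiCellsWeakGLevelsS, SkelPhiCellsFineGeomS): ONE of the four obligations of p3-g15's node theorem
`samePDropOfSkeletonFrm₁_of_choiceFnNQL` (C2-SPEC §4) for the choices of record, for EVERY slot value; (R)/(F)/(C) are the residue seats'.
What changes against N1: the column point `hcol` is the vertex over the STAGGERED centre `cenS x` (`hcol_fineA_atS`, from hp-8's `hcol_fineSkelS`), so the cube-radius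
row reads `NrepA (cenS x) + 1 ≤ rQ a x` — which is `NegB.colQ_schedOfS` by construction of `offNS`; the well-formedness `WFS2` is taken at the underlying `PCells2`
(`schedOfS_WFS2`); the arrival half-widths are the TRUNCATED slot value `bOf` so `bOf ≤ 3 r` (`bOf_le`) holds for every slot value.  The fine map is the UNCHANGED (ζ′) map `fineA` / `fineOA` ((R-22) option (i-a)).
* §1 `hcol_fineA_atS`, `hcol_fineA_of_schedS`; §2 **`geom_fineA_at_bS`** (the nine conjuncts, map slot `φ′`, any `b₀ ≤ 3r`, any creep value);
* §3 **`geomHoldsNQFn_frmChoiceAllQ3`**.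
builds on p205010 (kernel theorem, internal audit signed; external expert review pending) — nothing in this file uses p205010; NOTHING is claimed about the open node
`SamePDropOfSkeletonFrm₁` (`SamePDropOfSkeletonNeg₁` is CLOSED in the tree and untouched by this file).
Lane `prim-bschramm`, seat `prim-bschramm-stmt` (gen 20); helper file (`--supports stmt-CriticalPhenomena-4575 --as helper`); (Q-CF1) 2026-08-23T00:29Z, ruled (R-31) 00:35:58Z.
[cite: KozmaNitzan2024, §4 pp. 25–29 (Q_v, M_v, E_{v,x}, H^j_{v,x}; (29): columns)] [cite: MartineauTassion2017, §4.3]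
-/

noncomputable section

open scoped Classical

namespace Summit.CriticalPhenomena.PercolationContinuityZ3.Theorems.Transplant

open MeasureTheory Literature.Probability.Percolation Literature.Probability.LatticeModels SimpleGraph KNCells
open Literature.Barriers.CriticalPhenomena (HasExponentialGrowth graphBall)

namespace PlanarSkeletonFrm

open SkelConc (Consts)
open BoxProdZ2 (ConcRadiiG)
open Skelφ (oriφ trφ)
open Skelφ.StepI (DataN DataNS OutNS)

namespace NegB

open Neg

section Geom

variable (κ : Consts) {V : Type} [DecidableEq V] [Countable V] {G : SimpleGraph V} [G.LocallyFinite] (Φ : PlanarSkeletonFrm G) (t : V)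
  (p : unitInterval) (D : DataNS V) (g f : ℕ) (c : Fin 2 → ℕ)

/-! ## §1 The column point over the staggered centre -/

/-- **THE COLUMN POINT over the STAGGERED centre** for the fine map of the (ζ′) chain: for every cube `Q x` of the staggered cells `fcellsS … c` and every radius
`R ≥ NrepA (cenS x) + 1`, a vertex of fine position exactly `cenS x` inside the window span `VWin (Q x) R`. [cite: KozmaNitzan2024, §4 p. 26 ((29): columns)] -/
theorem hcol_fineA_atS {φ' : V → Site 2} (hlip : Skelφ.Lip G φ') (hstep : Skelφ.Steps G φ') (hN : EqNumL κ Φ t p D g f) (x : Site 2) {R : ℕ}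
    (hR : NrepA κ Φ t p D g f ((fcellsS κ Φ t p D g f c).cenS x) + 1 ≤ R) :
    ∃ y ∈ Skelφ.VWin G (fineA κ Φ t p D g f φ') t ((fcellsS κ Φ t p D g f c).Q x) R, fineA κ Φ t p D g f φ' y = (fcellsS κ Φ t p D g f c).cenS x := by
  obtain ⟨hn1, hℓ1⟩ := one_le_of_eqNumL κ Φ t p D g f hN
  obtain ⟨r0, r1⟩ := room_fcellsA_at κ Φ t p D g f hN
  have hD := Skelφ.NegPrm.DofA_pos (Aof_pos κ).2 hn1 hℓ1 (hL κ Φ t p D g f) (vL κ Φ t p D g f)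
  exact Skelφ.hcol_fineSkelS (A := Aof κ) (n := (nL κ Φ t p D g f : ℤ)) (h := hL κ Φ t p D g f) (vα := vL κ Φ t p D g f) (vβ := vβL κ Φ t p D g f) hlip hstep t
    (cA_pos κ Φ t p D g f 0) (cA_pos κ Φ t p D g f 1) hD r0 r1 (fcellsS κ Φ t p D g f c) x hR

/-- **`hcol` in the shape `sepGeomSG₂S` consumes**, from a schedule whose cube radii dominate the column radius at the staggered centres. [folklore] -/
theorem hcol_fineA_of_schedS {φ' : V → Site 2} (hlip : Skelφ.Lip G φ') (hstep : Skelφ.Steps G φ') (hN : EqNumL κ Φ t p D g f) {Λ : ConcRadiiG}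
    (hcolQ : ∀ a x, NrepA κ Φ t p D g f ((fcellsS κ Φ t p D g f c).cenS x) + 1 ≤ Λ.rQ a x) :
    ∀ a x, ∃ y ∈ Skelφ.VWin G (fineA κ Φ t p D g f φ') t ((fcellsS κ Φ t p D g f c).Q x) (Λ.rQ a x),
      fineA κ Φ t p D g f φ' y = (fcellsS κ Φ t p D g f c).cenS x :=
  fun a x => hcol_fineA_atS κ Φ t p D g f c hlip hstep hN x (hcolQ a x)

/-! ## §2 The nine conjuncts for the staggered cells with small boxes -/

/-- **THE NINE `GeomHoldsN` CONJUNCTS FOR THE STAGGERED CELLS WITH SMALL BOXES, map slot `φ′`** (`cellGeomSG₂bS … b₀` for any `b₀ ≤ 3r`, any creep value `c`).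
[cite: KozmaNitzan2024, §4 pp. 25–29] -/
theorem geom_fineA_at_bS {φ' : V → Site 2} (hlip : Skelφ.Lip G φ') (hstep : Skelφ.Steps G φ') (hN : EqNumL κ Φ t p D g f) {Λ : ConcRadiiG}
    (hΛ : Skelφ.WFS2 (fcellsS κ Φ t p D g f c).toPCells2 Λ) (hcolQ : ∀ a x, NrepA κ Φ t p D g f ((fcellsS κ Φ t p D g f c).cenS x) + 1 ≤ Λ.rQ a x)
    {b₀ : Fin 2 → ℕ} (hb : ∀ i, b₀ i ≤ 3 * (fcellsS κ Φ t p D g f c).r i) :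
    (Skelφ.cellGeomSG₂bS G (fineA κ Φ t p D g f φ') (fcellsS κ Φ t p D g f c) t Λ b₀).root = t ∧
      κ.K₀ ≤ (Skelφ.cellGeomSG₂bS G (fineA κ Φ t p D g f φ') (fcellsS κ Φ t p D g f c) t Λ b₀).K ∧
      Skelφ.Lip G (fineA κ Φ t p D g f φ') ∧
      RunGeom G (Skelφ.cellGeomSG₂bS G (fineA κ Φ t p D g f φ') (fcellsS κ Φ t p D g f c) t Λ b₀) ∧
      AnchGeom (Skelφ.cellGeomSG₂bS G (fineA κ Φ t p D g f φ') (fcellsS κ Φ t p D g f c) t Λ b₀) ∧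
      SepGeom₂ G (Skelφ.cellGeomSG₂bS G (fineA κ Φ t p D g f φ') (fcellsS κ Φ t p D g f c) t Λ b₀) ∧
      ExitGeom G (Skelφ.cellGeomSG₂bS G (fineA κ Φ t p D g f φ') (fcellsS κ Φ t p D g f c) t Λ b₀) ∧
      StepsGeom (Skelφ.cellGeomSG₂bS G (fineA κ Φ t p D g f φ') (fcellsS κ Φ t p D g f c) t Λ b₀)
        (Skelφ.faceDataSGS G (fineA κ Φ t p D g f φ') (fcellsS κ Φ t p D g f c) t Λ) ∧
      LevelGeom G (Skelφ.cellGeomSG₂bS G (fineA κ Φ t p D g f φ') (fcellsS κ Φ t p D g f c) t Λ b₀)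
        (Skelφ.faceDataSGS G (fineA κ Φ t p D g f φ') (fcellsS κ Φ t p D g f c) t Λ)
        (Skelφ.levelDataSS (fineA κ Φ t p D g f φ') (fcellsS κ Φ t p D g f c)) := by
  have hψ0 := fineA_base_at κ Φ t p D g f φ' hN
  have hlipψ := lip_fineA_at κ Φ t p D g f hlip hN
  have hws := weakSteps_fineA_at κ Φ t p D g f hstep hN
  have hcol := hcol_fineA_of_schedS κ Φ t p D g f c hlip hstep hN hcolQ
  refine ⟨rfl, (fcellsA_K κ Φ t p D g f).2.1, hlipψ, Skelφ.runGeomSG₂bS _ _ _, Skelφ.anchGeomSG₂bS _ _ _,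
    Skelφ.sepGeom₂SG₂bS _ _ _ hΛ hψ0 hlipψ hws hcol, Skelφ.exitGeomSG₂bS _ _ _ hΛ hlipψ hb, Skelφ.stepsGeomSG₂bS _ _ _ hΛ hlipψ hws hb,
    Skelφ.levelGeomSG₂bS _ _ _ hΛ hlipψ hb⟩

end Geom

end NegB

/-! ## §3 The geometric obligation of the choice function of record -/

/-- **`GeomHoldsNQFn (frmChoiceAllQ3 gv fv Pv Sv cv bv)` FOR EVERY SLOT VALUE** (the N2 scheme over the staggered cells; `bOf ≤ 3r` by `bOf_le`, the column floor at the
staggered centre by `colQ_schedOfS`, the long clause from `FactsNS`). [cite: KozmaNitzan2024, §4 pp. 25–29] -/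
theorem geomHoldsNQFn_frmChoiceAllQ3 (gv fv : Neg.FSlot) (Pv : NegB.PSlot) (Sv : NegB.SSlot) (cv : NegB.CSlot) (bv : NegB.BSlot) :
    GeomHoldsNQFn (frmChoiceAllQ3 gv fv Pv Sv cv bv) := by
  intro κ V _ _ G _ Φ hg t ht h1 p hp0 hp1 hC O q hAt
  obtain ⟨-, -, hR, -, -⟩ := Skelφ.StepI.OutO.FactsO.shared hAt.1.factsO
  obtain ⟨h1', h2, -, h4, h5, h6, h7, h8, h9⟩ := NegB.geom_fineA_at_bS κ Φ t p O.merged (NegB.gOf κ Φ t p O gv) (NegB.fOf κ Φ t p O fv)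
    (NegB.cOf κ Φ t p O gv fv cv)
    (NegB.lip_φL κ Φ t p O.D O.DT.toDataN O.ori (NegB.gOf κ Φ t p O gv) (NegB.fOf κ Φ t p O fv))
    (NegB.steps_φL κ Φ t p O.D O.DT.toDataN O.ori (NegB.gOf κ Φ t p O gv) (NegB.fOf κ Φ t p O fv))
    (NegB.eqNumL_of_factsO κ Φ t p O.D O.DT.toDataN O.ori _ _ hR (Skelφ.StepI.OutO.FactsO.clauses hAt.1.factsO))
    (NegB.schedOfS_WFS2 κ Φ t p O.merged (NegB.gOf κ Φ t p O gv) (NegB.fOf κ Φ t p O fv) (NegB.cOf κ Φ t p O gv fv cv)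
      (Sv κ Φ t p O.merged (NegB.gOf κ Φ t p O gv) (NegB.fOf κ Φ t p O fv) q))
    (NegB.colQ_schedOfS κ Φ t p O.merged (NegB.gOf κ Φ t p O gv) (NegB.fOf κ Φ t p O fv) (NegB.cOf κ Φ t p O gv fv cv)
      (Sv κ Φ t p O.merged (NegB.gOf κ Φ t p O gv) (NegB.fOf κ Φ t p O fv) q))
    (NegB.bOf_le κ Φ t p O gv fv cv bv)
  exact ⟨h1', h2, h4, h5, h6, h7, h8, h9⟩

end PlanarSkeletonFrm

end Summit.CriticalPhenomena.PercolationContinuityZ3.Theorems.Transplant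

end
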